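/-
Copyright (c) 2026. All rights reserved.
Released under Apache 2.0 license as described in the file LICENSE.
-/
import Summits.Langlands.Langlands.Theorems.SoloInformedGLOneWeilAvatar
import Literature.NumberTheory.Automorphic.LocalComponentBJUniqueProofs
import Literature.NumberTheory.GaloisRepresentations.DeRhamLAdicCharacterHecke
import Literature.NumberTheory.GaloisRepresentations.LAdicCharacterUnramifiedAEProofs
import HarnessLib

/-!
# Clause (B) of the summit for `GL₁`, and the whole `n = 1` conjunct, decided up to the pinned datum

File Λ22 of the programme `solo-Langlands-informed`.  Λ21 (`SoloInformedGLOneWeilAvatar`) proved that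
clause (A) = `AutomorphicToGalois 1 𝓡 hcpt` is equivalent to two properties of the pinned Fontaine
datum `𝓡.pst ℓ v hv = fontainePstAdicCompletion v ℓ hv` on Weil's `ℓ`-adic characters
`r_{θ,ι} = HasInfinityType.weilRep hinf hmod ι` of the algebraic Hecke characters `θ` of `K`.  This
file does the same for clause (B) = `GaloisToAutomorphic 1 𝓡 hcpt` (Fontaine–Mazur–Langlands) and for
the `n = 1` conjunct `GlobalLanglandsCorrespondenceGLn 1 K 𝓡 hcpt` of the summit.

* §1 rank-one rigidities: every local component at `v` of ANY automorphic `π` of `GL₁/K` with Hecke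
  character `θ` is `θ_v ∘ det` (Λ21 + Flath uniqueness `hasLocalComponentAt_unique_holds`);
  `IsGeometricFramed 𝓡 ρ ↔ ∀ v ∣ ℓ, (𝓡.pst ℓ v hv).IsDeRhamFramed ρ|Γ_{K_v}` in rank one (an `ℓ`-adic
  character is unramified a.e.); a `ρ` with Weil's Frobenius dictionary `X - ι⁻¹(θ(ϖ_v))⁻¹` a.e. IS
  `r_{θ,ι}` (Chebotarev), and `θ ↦ r_{θ,ι}` is injective (multiplicity one for `GL₁`).
* §2 the two in-print theorems that the tree keeps as NAMED FACTS about the pinned datum, in avatar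
  form: `FramedGaloisRep.exists_heckeCharacter_of_isDeRhamFramed` [Patrikis 2019 Prop. 2.2.1; Serre
  III §2.3 + App. A] gives "`ρ` de Rham for the pinned datum at every `v ∣ ℓ` ⟹ `ρ = r_{θ,ι}`", and
  `HeckeCharacter.exists_lAdic_isDeRhamFramed` [Serre III §2.3, App. A; Conrad App. B.4] gives
  "`r_{θ,ι}` is de Rham for the pinned datum at every `v ∣ ℓ`".  Both concern the CONSTRUCTED
  `B_dR(K_v)` (`isDeRhamFramed_pst_iff_bdR`), not the `Classical.epsilon`-chosen Weil–Deligne functor.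
* §3 ★ `galoisToAutomorphic_one_iff`: (B)₁ ⟺ every rank-one `ρ` the pinned datum declares de Rham at
  every `v ∣ ℓ` is a Weil character `r_{θ,ι}` AND the datum attaches to `ρ|Γ_{K_v}` (`v ∣ ℓ`) a
  Weil–Deligne representation of `ι`-class `rec₁(θ_v ∘ det) = [(θ_v ∘ Art_v, 0)]`;
  ★ `galoisToAutomorphic_one_iff_fm_and_wd` splits this into (FM₁) and (WD₁); granting
  Fontaine–Mazur for characters, (B)₁ = (WD₁) and (A)₁ ⟹ (B)₁.
* §4 ★★ `globalLanglandsCorrespondenceGLn_one_iff_pst`: the summit's `n = 1` conjunct over `K` ⟺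
  (∀ θ ℓ ι, ∀ v ∣ ℓ: pinned de Rham verdict on `r_{θ,ι}` ∧ pinned WD value `rec₁(θ_v ∘ det)`) ∧ (FM₁);
  ★★ `globalLanglandsCorrespondenceGLn_one_iff_wd_of_facts`: GRANTING the two named facts of §2, the
  `n = 1` conjunct is EXACTLY "the pinned datum attaches the class `rec₁(θ_v ∘ det)` to every Weil
  character at every `v ∣ ℓ`" — the property left undetermined by the datum's specification
  (`SoloInformedPinExclusionSpec`).

No definitions.  Citations: [Weil1956] §§1–2; [SerreAbelianLadic1968] I §2.3, II §2.7, III §2.3,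
App. A; [Patrikis2019] Prop. 2.2.1; [Conrad2011LiftingGlobal] App. B Prop. B.4;
[FontaineMazurGeometric1995] §1, Conj. 1; [BuzzardGeeLMS2014] Conj. 3.2.1–3.2.2, Rem. 3.2.5;
[TaylorGaloisRepresentations2004] Conj. 7–8; [FlathCorvallis1979] Thm 3–4; [BorelJacquet1979] §4.6;
[CasselsFrohlichANT1967] VII §4; [FontaineAsterisque223VIII] §2.3.7.
-/

noncomputable section
open scoped MatrixGroups Matrix Classical Polynomial NumberField
open NumberField IsDedekindDomain Field Polynomial Filter
open Literature.NumberTheory.Automorphic Literature.NumberTheory.GaloisRepresentations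

namespace Summit.Langlands.Langlands.Theorems

namespace GLOneRigidity

section ClauseB

variable {K : Type} [Field K] [NumberField K] {hcpt : isCompact_glFiniteIntegralLevel 1 K}
  {ℓ : ℕ} [Fact ℓ.Prime] {θ : HeckeCharacter K} {p q : InfinitePlace K → ℤ}
  {T : Finset (HeightOneSpectrum (𝓞 K))} {e : HeightOneSpectrum (𝓞 K) → ℕ}

/-! ### §1 Three rank-one rigidities -/

/-- **Every local component at `v` of an automorphic `π` of `GL₁/K` with Hecke character `θ` is
`θ_v ∘ det`**, for ANY Borel–Jacquet datum `π` on which the ideles act through `θ ∘ det` modulo `π.W'`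
(Λ21 exhibits `θ_v ∘ det` as a local component; local components are unique up to isomorphism).
[cite: FlathCorvallis1979, Thm. 3 and Thm. 4] [cite: BorelJacquet1979, §4.6] -/
theorem irrClass_eq_ofQuasiChar_of_hasLocalComponentAt'
    (π : AutomorphicRepData (AutomorphyDatum.gl 1 K hcpt))
    (hχ : ∀ (g : (AdelicGroupData.gl 1 K).Adelic), ∀ φ ∈ π.W,
      rightTranslation (AdelicGroupData.gl 1 K) g φ -
        ((θ (Matrix.GeneralLinearGroup.det g) : ℂˣ) : ℂ) • φ ∈ π.W')
    {v : HeightOneSpectrum (𝓞 K)} {πv : SmoothIrrep (GL (Fin 1) (v.adicCompletion K))}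
    (h : π.HasLocalComponentAt v πv.ρ) :
    IrrClass.mk πv =
      IrrClass.mk (SmoothIrrep.ofQuasiChar
        (⟨θ.localComponent v, θ.continuous_localComponent v⟩ : QuasiChar (v.adicCompletion K))) :=
  AutomorphicRepData.hasLocalComponentAt_unique_holds π v πv _ h
    (hasLocalComponentAt_ofQuasiChar_of_heckeCharacter π hχ v)

/-- **In rank one, `IsGeometricFramed` is the pinned de Rham verdict alone**: a continuous `ℓ`-adic
character of `Γ_K` is unramified at all but finitely many places (`eventually_isUnramifiedAt_of_rank_one`).
[cite: SerreAbelianLadic1968, III §2.2] [cite: FontaineMazurGeometric1995, §1] -/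
theorem isGeometricFramed_iff_isDeRhamFramed_of_rank_one (𝓡 : ReciprocityData K)
    (ρ : FramedGaloisRep K (PadicAlgCl ℓ) 1) :
    IsGeometricFramed 𝓡 ρ ↔
      ∀ (v : HeightOneSpectrum (𝓞 K)) (hv : ((ℓ : ℕ) : 𝓞 K) ∈ v.asIdeal),
        (𝓡.pst ℓ v hv).IsDeRhamFramed (ρ.toLocal v) :=
  ⟨fun h => h.2, fun h => ⟨ρ.eventually_isUnramifiedAt_of_rank_one, h⟩⟩

/-- All but finitely many finite places are prime to `ℓ`. [folklore] -/
private theorem eventually_not_mem_asIdeal_ℓ :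
    ∀ᶠ v : HeightOneSpectrum (𝓞 K) in cofinite, ((ℓ : ℕ) : 𝓞 K) ∉ v.asIdeal :=
  Literature.RingTheory.DedekindDomain.eventually_not_mem_asIdeal
    (Nat.cast_ne_zero.mpr (Fact.out : ℓ.Prime).ne_zero)

/-- **Frobenius rigidity**: a framed `ρ : Γ_K → GL₁(ℚ̄_ℓ)` whose arithmetic Frobenii have
characteristic polynomial `X - ι⁻¹(θ(ϖ_v))⁻¹` at all but finitely many `v` — the dictionary of Weil's
theorem and of the named fact `FramedGaloisRep.exists_heckeCharacter_of_isDeRhamFramed` — IS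
`r_{θ,ι}` (Chebotarev density, `FramedGaloisRep.eq_or_eq_of_frobenius`; a `1 × 1` matrix is its
characteristic polynomial). [cite: SerreAbelianLadic1968, I §2.3 and II §2.7] [cite: Weil1956, §1] -/
theorem eq_weilRep_of_eventually_hasFrobCharpolyAt (ι : PadicAlgCl ℓ ≃+* ℂ)
    (hinf : θ.HasInfinityType p q) (hmod : HeckeCharacter.IsModulus θ T e)
    {ρ : FramedGaloisRep K (PadicAlgCl ℓ) 1}
    (h : ∀ᶠ v : HeightOneSpectrum (𝓞 K) in cofinite,
      ρ.HasFrobCharpolyAt v (X - C (ι.symm (θ.valueAtUniformizer v)⁻¹))) :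
    ρ = hinf.weilRep hmod ι := by
  have hr : ∀ᶠ v : HeightOneSpectrum (𝓞 K) in cofinite,
      (hinf.weilRep hmod ι).HasFrobCharpolyAt v (X - C (ι.symm (θ.valueAtUniformizer v)⁻¹)) := by
    filter_upwards [T.eventually_cofinite_notMem, eventually_not_mem_asIdeal_ℓ (K := K) (ℓ := ℓ)]
      with v hvT hvℓ
    exact hinf.hasFrobCharpolyAt_weilRep hmod ι hvT hvℓ
  have hS := Filter.eventually_cofinite.1 (h.and hr)
  refine (FramedGaloisRep.eq_or_eq_of_frobenius ρ _ _ hS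
    fun v hv 𝔓 h𝔓 σ hσ => Or.inl ?_).elim id id
  simp only [Set.mem_setOf_eq, not_not] at hv
  exact FramedRep.apply_eq_of_charpoly_eq ((hv.1 𝔓 h𝔓 σ hσ).trans (hv.2 𝔓 h𝔓 σ hσ).symm)

/-- **`θ ↦ r_{θ,ι}` is injective** (multiplicity one for `GL₁`): the Frobenius values
`ι⁻¹(θ(ϖ_v))⁻¹` of `r_{θ,ι}` at almost all `v` determine `θ(ϖ_v)` there, and a Hecke character is
determined by its values at almost all uniformisers (`HeckeCharacter.ext_of_eventually_valueAtUniformizer_eq`).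
[cite: CasselsFrohlichANT1967, Ch. VII §4 Prop. 4.1] [cite: SerreAbelianLadic1968, II §2.7] -/
theorem heckeCharacter_eq_of_weilRep_eq (ι : PadicAlgCl ℓ ≃+* ℂ) (hinf : θ.HasInfinityType p q)
    (hmod : HeckeCharacter.IsModulus θ T e) {θ' : HeckeCharacter K} {p' q' : InfinitePlace K → ℤ}
    (hinf' : θ'.HasInfinityType p' q') {T' : Finset (HeightOneSpectrum (𝓞 K))}
    {e' : HeightOneSpectrum (𝓞 K) → ℕ} (hmod' : HeckeCharacter.IsModulus θ' T' e')
    (h : hinf.weilRep hmod ι = hinf'.weilRep hmod' ι) : θ = θ' := by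
  refine HeckeCharacter.ext_of_eventually_valueAtUniformizer_eq ?_
  filter_upwards [T.eventually_cofinite_notMem, T'.eventually_cofinite_notMem,
    eventually_not_mem_asIdeal_ℓ (K := K) (ℓ := ℓ)] with v hvT hvT' hvℓ
  obtain ⟨𝔓, h𝔓⟩ := v.primesAbove_nonempty
  obtain ⟨σ, hσ⟩ := HeightOneSpectrum.exists_isArithFrobAt_of_mem_primesAbove_holds h𝔓
  have h₁ := FramedGaloisRep.apply_eq_of_hasFrobCharpolyAt
    (hinf.hasFrobCharpolyAt_weilRep hmod ι hvT hvℓ) h𝔓 hσ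
  have h₂ := FramedGaloisRep.apply_eq_of_hasFrobCharpolyAt
    (hinf'.hasFrobCharpolyAt_weilRep hmod' ι hvT' hvℓ) h𝔓 hσ
  rw [h] at h₁
  exact inv_injective (ι.symm.injective (h₁.symm.trans h₂))

/-! ### §2 The two named facts about the pinned datum on characters, in avatar form -/

/-- **Fontaine–Mazur–Langlands for `GL₁`, avatar form** (granting the named fact
`FramedGaloisRep.exists_heckeCharacter_of_isDeRhamFramed`): a framed `ρ : Γ_K → GL₁(ℚ̄_ℓ)` which the
pinned datum declares de Rham at every `v ∣ ℓ` IS Weil's `r_{θ,ι}` for an algebraic Hecke character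
`θ` (any witnesses `hinf`, `hmod`).  [cite: Patrikis2019, Prop. 2.2.1]
[cite: SerreAbelianLadic1968, III §2.3 Thm. 2 and App. A] [cite: Conrad2011LiftingGlobal, App. B, Prop. B.4] -/
theorem exists_eq_weilRep_of_isDeRhamFramed
    (hFM : FramedGaloisRep.exists_heckeCharacter_of_isDeRhamFramed) (𝓡 : ReciprocityData K)
    (ι : PadicAlgCl ℓ ≃+* ℂ) (ρ : FramedGaloisRep K (PadicAlgCl ℓ) 1)
    (hdR : ∀ (v : HeightOneSpectrum (𝓞 K)) (hv : ((ℓ : ℕ) : 𝓞 K) ∈ v.asIdeal),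
      (𝓡.pst ℓ v hv).IsDeRhamFramed (ρ.toLocal v)) :
    ∃ (θ : HeckeCharacter K) (p q : InfinitePlace K → ℤ) (hinf : θ.HasInfinityType p q)
      (T : Finset (HeightOneSpectrum (𝓞 K))) (e : HeightOneSpectrum (𝓞 K) → ℕ)
      (hmod : HeckeCharacter.IsModulus θ T e), ρ = hinf.weilRep hmod ι := by
  obtain ⟨χ, hχ, h⟩ := hFM K ℓ ρ (fun v hv => hdR v hv) ι
  obtain ⟨p, q, hinf⟩ := χ.isAlgebraic_iff_exists_hasInfinityType.mp hχ
  obtain ⟨T, e, hmod⟩ := χ.exists_isModulus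
  exact ⟨χ, p, q, hinf, T, e, hmod,
    eq_weilRep_of_eventually_hasFrobCharpolyAt ι hinf hmod (h.mono fun v hv => hv.2.2)⟩

/-- Conversely `ρ = r_{θ,ι}` returns the named fact's own conclusion for `ρ` (`θ` algebraic; `θ` and
`r_{θ,ι}` unramified with the Frobenius dictionary a.e.). [cite: SerreAbelianLadic1968, II §2.7] -/
theorem exists_heckeCharacter_of_eq_weilRep (ι : PadicAlgCl ℓ ≃+* ℂ) (hinf : θ.HasInfinityType p q)
    (hmod : HeckeCharacter.IsModulus θ T e) {ρ : FramedGaloisRep K (PadicAlgCl ℓ) 1}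
    (hρ : ρ = hinf.weilRep hmod ι) :
    ∃ χ : HeckeCharacter K, χ.IsAlgebraic ∧
      ∀ᶠ v : HeightOneSpectrum (𝓞 K) in cofinite, χ.IsUnramifiedAt v ∧ ρ.IsUnramifiedAt v ∧
        ρ.HasFrobCharpolyAt v (X - C (ι.symm (χ.valueAtUniformizer v)⁻¹)) := by
  subst hρ
  refine ⟨θ, θ.isAlgebraic_iff_exists_hasInfinityType.mpr ⟨p, q, hinf⟩, ?_⟩
  filter_upwards [T.eventually_cofinite_notMem, eventually_not_mem_asIdeal_ℓ (K := K) (ℓ := ℓ)]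
    with v hvT hvℓ
  exact ⟨HeckeCharacter.isUnramifiedAt_of_isModulus' hmod hvT,
    hinf.isUnramifiedAt_weilRep hmod ι hvT hvℓ, hinf.hasFrobCharpolyAt_weilRep hmod ι hvT hvℓ⟩

/-- **`r_{θ,ι}` is de Rham for the pinned datum at every `v ∣ ℓ`** (granting the named fact
`HeckeCharacter.exists_lAdic_isDeRhamFramed`: its `r` has Weil's Frobenius dictionary wherever `θ`
is unramified and `v ∤ ℓ`, hence is `r_{θ,ι}` by §1).
[cite: SerreAbelianLadic1968, III §2.3 and App. A2–A5] [cite: Conrad2011LiftingGlobal, App. B, Prop. B.4] -/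
theorem isDeRhamFramed_weilRep_of_fact (hDR : HeckeCharacter.exists_lAdic_isDeRhamFramed)
    (𝓡 : ReciprocityData K) (ι : PadicAlgCl ℓ ≃+* ℂ) (hinf : θ.HasInfinityType p q)
    (hmod : HeckeCharacter.IsModulus θ T e) (v : HeightOneSpectrum (𝓞 K))
    (hv : ((ℓ : ℕ) : 𝓞 K) ∈ v.asIdeal) :
    (𝓡.pst ℓ v hv).IsDeRhamFramed ((hinf.weilRep hmod ι).toLocal v) := by
  obtain ⟨r, hr, hdR⟩ := hDR K ℓ θ (θ.isAlgebraic_iff_exists_hasInfinityType.mpr ⟨p, q, hinf⟩) ι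
  obtain rfl : r = hinf.weilRep hmod ι := by
    refine eq_weilRep_of_eventually_hasFrobCharpolyAt ι hinf hmod ?_
    filter_upwards [T.eventually_cofinite_notMem, eventually_not_mem_asIdeal_ℓ (K := K) (ℓ := ℓ)]
      with w hwT hwℓ
    exact (hr w hwℓ (HeckeCharacter.isUnramifiedAt_of_isModulus' hmod hwT)).2
  exact hdR v hv

/-! ### §3 Clause (B) for `GL₁` ⟺ the pinned datum on de Rham characters -/

/-- ★ **Clause (B) of the summit for `n = 1`, decided up to the pinned Fontaine datum.**
`GaloisToAutomorphic 1 𝓡 hcpt` holds iff for every `ℓ`, `ι : ℚ̄_ℓ ≃ ℂ` and every framed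
`ρ : Γ_K → GL₁(ℚ̄_ℓ)` that the datum `𝓡.pst ℓ v hv` declares de Rham at every `v ∣ ℓ`:
(i) `ρ = r_{θ,ι}` for an algebraic Hecke character `θ`, and (ii) at every `v ∣ ℓ` the datum attaches
to `ρ|Γ_{K_v}` a Weil–Deligne representation whose `ι`-transport has class `rec₁(θ_v ∘ det)`.
(→): irreducibility and unramifiedness a.e. are automatic in rank one; (B) gives a cuspidal
`L`-algebraic `π` corresponding to `ρ`; its Hecke character `θ` is algebraic [Clozel §3.3],
`ρ = r_{θ,ι}` by Λ21 rigidity, and every local component of `π` is `θ_v ∘ det` (§1), which unfolds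
local–global compatibility at `v ∣ ℓ` to (ii).  (←): `π := θ ∘ det` and Λ21 §§2–4.
[cite: FontaineMazurGeometric1995, Conj. 1] [cite: BuzzardGeeLMS2014, Conj. 3.2.2 and Rem. 3.2.5]
[cite: TaylorGaloisRepresentations2004, Conj. 8] [cite: Weil1956, §§1–2] -/
theorem galoisToAutomorphic_one_iff (𝓡 : ReciprocityData K) :
    GaloisToAutomorphic 1 𝓡 hcpt ↔
      ∀ (ℓ : ℕ) [Fact ℓ.Prime] (ι : PadicAlgCl ℓ ≃+* ℂ) (ρ : FramedGaloisRep K (PadicAlgCl ℓ) 1),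
        (∀ (v : HeightOneSpectrum (𝓞 K)) (hv : ((ℓ : ℕ) : 𝓞 K) ∈ v.asIdeal),
          (𝓡.pst ℓ v hv).IsDeRhamFramed (ρ.toLocal v)) →
        ∃ (θ : HeckeCharacter K) (p q : InfinitePlace K → ℤ) (hinf : θ.HasInfinityType p q)
          (T : Finset (HeightOneSpectrum (𝓞 K))) (e : HeightOneSpectrum (𝓞 K) → ℕ)
          (hmod : HeckeCharacter.IsModulus θ T e),
          ρ = hinf.weilRep hmod ι ∧
          ∀ (v : HeightOneSpectrum (𝓞 K)) (hv : ((ℓ : ℕ) : 𝓞 K) ∈ v.asIdeal),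
            ∃ (r : WeilDeligneRep (v.adicCompletion K) (PadicAlgCl ℓ) (Fin 1 → PadicAlgCl ℓ))
              (rℂ : WeilDeligneRep (v.adicCompletion K) ℂ (Fin 1 → ℂ)),
              (𝓡.pst ℓ v hv).IsWeilDeligneOf (ρ.toLocal v) r ∧
                r.IsTransportAlong (ι : PadicAlgCl ℓ →+* ℂ) rℂ ∧
                rℂ.HasFrobSemisimpleClass
                  ((𝓡.llc v).recGL 1 (IrrClass.mk (SmoothIrrep.ofQuasiChar
                    (⟨θ.localComponent v, θ.continuous_localComponent v⟩ :
                      QuasiChar (v.adicCompletion K))))) := by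
  constructor
  · intro hB ℓ _ ι ρ hdR
    obtain ⟨π, hL, hcor⟩ := hB ℓ ι ρ (isIrreducible_of_finrank_eq_one' _ (Module.finrank_fin_fun _))
      ((isGeometricFramed_iff_isDeRhamFramed_of_rank_one 𝓡 ρ).mpr hdR)
    obtain ⟨θ, hχ⟩ := π.1.exists_heckeCharacter_glOne
    obtain ⟨T₀, hT₀, hL⟩ := hL
    obtain ⟨p, q, hinf⟩ := π.1.exists_hasInfinityType_heckeCharacter_glOne hχ hT₀
      ((InfinityType.isCAlgebraic_iff_isLAlgebraic_of_odd odd_one T₀).mpr hL)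
    obtain ⟨T, e, hmod⟩ := θ.exists_isModulus
    refine ⟨θ, p, q, hinf, T, e, hmod, eq_weilRep_of_corresponds 𝓡 ι π.1 hχ hinf hmod hcor,
      fun v hv => ?_⟩
    obtain ⟨πv, r, rℂ, hπv, -, h₂, h₃, h₄⟩ := hcor.2 v
    rw [irrClass_eq_ofQuasiChar_of_hasLocalComponentAt' π.1 hχ hπv] at h₄
    exact ⟨r, rℂ, h₂ hv, h₃, h₄⟩
  · intro h ℓ _ ι ρ _ hgeo
    obtain ⟨θ, p, q, hinf, T, e, hmod, hρ, hpst⟩ := h ℓ ι ρ hgeo.2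
    subst hρ
    obtain ⟨π, hW, -⟩ := exists_cuspidal_detTwist_glOne hcpt θ
    have hχ := heckeCharacter_detTwist_glOne hW
    refine ⟨π, isLAlgebraic_of_hasInfinityType_heckeCharacter_glOne π.1 hχ hinf,
      eventually_satakeFrobCompatibleAt_weilRep ι π.1 hχ hinf hmod, fun v => ?_⟩
    by_cases hv : ((ℓ : ℕ) : 𝓞 K) ∈ v.asIdeal
    · exact localGlobalCompatibleAt_weilRep_of_pst 𝓡 ι π.1 hχ hinf hmod hv (hpst v hv)
    · exact localGlobalCompatibleAt_weilRep_away 𝓡 ι π.1 hχ hinf hmod hv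

/-- ★ **Clause (B) for `n = 1` = (FM₁) ∧ (WD₁).**  (FM₁): every framed rank-one `ρ` declared de Rham
by the pinned datum at every `v ∣ ℓ` is a Weil character `r_{θ,ι}` (Fontaine–Mazur–Langlands for
`GL₁`, a theorem in print for the genuine `B_dR`: the named fact of §2).  (WD₁): on every Weil
character `r_{θ,ι}` that the datum declares de Rham above `ℓ`, the datum's Weil–Deligne value at each
`v ∣ ℓ` has `ι`-class `rec₁(θ_v ∘ det)`.  The splitting uses the injectivity of `θ ↦ r_{θ,ι}` (§1).
[cite: FontaineMazurGeometric1995, Conj. 1] [cite: BuzzardGeeLMS2014, Conj. 3.2.2 and Rem. 3.2.5]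
[cite: FontaineAsterisque223VIII, §2.3.7] -/
theorem galoisToAutomorphic_one_iff_fm_and_wd (𝓡 : ReciprocityData K) :
    GaloisToAutomorphic 1 𝓡 hcpt ↔
      (∀ (ℓ : ℕ) [Fact ℓ.Prime] (ι : PadicAlgCl ℓ ≃+* ℂ) (ρ : FramedGaloisRep K (PadicAlgCl ℓ) 1),
        (∀ (v : HeightOneSpectrum (𝓞 K)) (hv : ((ℓ : ℕ) : 𝓞 K) ∈ v.asIdeal),
          (𝓡.pst ℓ v hv).IsDeRhamFramed (ρ.toLocal v)) →
        ∃ (θ : HeckeCharacter K) (p q : InfinitePlace K → ℤ) (hinf : θ.HasInfinityType p q)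
          (T : Finset (HeightOneSpectrum (𝓞 K))) (e : HeightOneSpectrum (𝓞 K) → ℕ)
          (hmod : HeckeCharacter.IsModulus θ T e), ρ = hinf.weilRep hmod ι) ∧
      ∀ (θ : HeckeCharacter K) (p q : InfinitePlace K → ℤ) (hinf : θ.HasInfinityType p q)
        (T : Finset (HeightOneSpectrum (𝓞 K))) (e : HeightOneSpectrum (𝓞 K) → ℕ)
        (hmod : HeckeCharacter.IsModulus θ T e) (ℓ : ℕ) [Fact ℓ.Prime] (ι : PadicAlgCl ℓ ≃+* ℂ),
        (∀ (v : HeightOneSpectrum (𝓞 K)) (hv : ((ℓ : ℕ) : 𝓞 K) ∈ v.asIdeal),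
          (𝓡.pst ℓ v hv).IsDeRhamFramed ((hinf.weilRep hmod ι).toLocal v)) →
        ∀ (v : HeightOneSpectrum (𝓞 K)) (hv : ((ℓ : ℕ) : 𝓞 K) ∈ v.asIdeal),
          ∃ (r : WeilDeligneRep (v.adicCompletion K) (PadicAlgCl ℓ) (Fin 1 → PadicAlgCl ℓ))
            (rℂ : WeilDeligneRep (v.adicCompletion K) ℂ (Fin 1 → ℂ)),
            (𝓡.pst ℓ v hv).IsWeilDeligneOf ((hinf.weilRep hmod ι).toLocal v) r ∧
              r.IsTransportAlong (ι : PadicAlgCl ℓ →+* ℂ) rℂ ∧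
              rℂ.HasFrobSemisimpleClass
                ((𝓡.llc v).recGL 1 (IrrClass.mk (SmoothIrrep.ofQuasiChar
                  (⟨θ.localComponent v, θ.continuous_localComponent v⟩ :
                    QuasiChar (v.adicCompletion K))))) := by
  rw [galoisToAutomorphic_one_iff 𝓡]
  refine ⟨fun h => ⟨fun ℓ _ ι ρ hdR => ?_, fun θ p q hinf T e hmod ℓ _ ι hdR => ?_⟩,
    fun h ℓ _ ι ρ hdR => ?_⟩
  · obtain ⟨θ, p, q, hinf, T, e, hmod, hρ, -⟩ := h ℓ ι ρ hdR
    exact ⟨θ, p, q, hinf, T, e, hmod, hρ⟩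
  · obtain ⟨θ', p', q', hinf', T', e', hmod', hρ, hwd⟩ := h ℓ ι _ hdR
    obtain rfl : θ = θ' := heckeCharacter_eq_of_weilRep_eq ι hinf hmod hinf' hmod' hρ
    exact hwd
  · obtain ⟨θ, p, q, hinf, T, e, hmod, hρ⟩ := h.1 ℓ ι ρ hdR
    subst hρ
    exact ⟨θ, p, q, hinf, T, e, hmod, rfl, h.2 θ p q hinf T e hmod ℓ ι hdR⟩

/-- **Granting Fontaine–Mazur for characters (the named fact of §2), clause (B) for `n = 1` is (WD₁)
alone** — a property of the `Classical.epsilon`-pinned datum on Weil's characters.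
[cite: Patrikis2019, Prop. 2.2.1] [cite: BuzzardGeeLMS2014, Conj. 3.2.2 and Rem. 3.2.5] -/
theorem galoisToAutomorphic_one_iff_wd_of_fact
    (hFM : FramedGaloisRep.exists_heckeCharacter_of_isDeRhamFramed) (𝓡 : ReciprocityData K) :
    GaloisToAutomorphic 1 𝓡 hcpt ↔
      ∀ (θ : HeckeCharacter K) (p q : InfinitePlace K → ℤ) (hinf : θ.HasInfinityType p q)
        (T : Finset (HeightOneSpectrum (𝓞 K))) (e : HeightOneSpectrum (𝓞 K) → ℕ)
        (hmod : HeckeCharacter.IsModulus θ T e) (ℓ : ℕ) [Fact ℓ.Prime] (ι : PadicAlgCl ℓ ≃+* ℂ),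
        (∀ (v : HeightOneSpectrum (𝓞 K)) (hv : ((ℓ : ℕ) : 𝓞 K) ∈ v.asIdeal),
          (𝓡.pst ℓ v hv).IsDeRhamFramed ((hinf.weilRep hmod ι).toLocal v)) →
        ∀ (v : HeightOneSpectrum (𝓞 K)) (hv : ((ℓ : ℕ) : 𝓞 K) ∈ v.asIdeal),
          ∃ (r : WeilDeligneRep (v.adicCompletion K) (PadicAlgCl ℓ) (Fin 1 → PadicAlgCl ℓ))
            (rℂ : WeilDeligneRep (v.adicCompletion K) ℂ (Fin 1 → ℂ)),
            (𝓡.pst ℓ v hv).IsWeilDeligneOf ((hinf.weilRep hmod ι).toLocal v) r ∧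
              r.IsTransportAlong (ι : PadicAlgCl ℓ →+* ℂ) rℂ ∧
              rℂ.HasFrobSemisimpleClass
                ((𝓡.llc v).recGL 1 (IrrClass.mk (SmoothIrrep.ofQuasiChar
                  (⟨θ.localComponent v, θ.continuous_localComponent v⟩ :
                    QuasiChar (v.adicCompletion K))))) := by
  rw [galoisToAutomorphic_one_iff_fm_and_wd 𝓡]
  exact ⟨fun h => h.2, fun h =>
    ⟨fun ℓ _ ι ρ hdR => exists_eq_weilRep_of_isDeRhamFramed hFM 𝓡 ι ρ hdR, h⟩⟩

/-- **Granting Fontaine–Mazur for characters, (A)₁ ⟹ (B)₁**: clause (A) for `GL₁` asserts the pinned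
WD value on every Weil character (Λ21 `pst_weilRep_of_automorphicToGalois`), which is (WD₁).
[cite: BuzzardGeeLMS2014, Conj. 3.2.1 and Conj. 3.2.2] [cite: Patrikis2019, Prop. 2.2.1] -/
theorem galoisToAutomorphic_one_of_automorphicToGalois
    (hFM : FramedGaloisRep.exists_heckeCharacter_of_isDeRhamFramed) (𝓡 : ReciprocityData K)
    (hA : AutomorphicToGalois 1 𝓡 hcpt) : GaloisToAutomorphic 1 𝓡 hcpt :=
  (galoisToAutomorphic_one_iff_wd_of_fact hFM 𝓡).mpr fun _ _ _ hinf _ _ hmod _ _ ι _ v hv =>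
    (pst_weilRep_of_automorphicToGalois 𝓡 hA hinf hmod ι v hv).2

/-! ### §4 The `n = 1` conjunct of the summit -/

/-- ★★ **The summit's `n = 1` conjunct over `K`, decided up to the pinned datum.**
`GlobalLanglandsCorrespondenceGLn 1 K 𝓡 hcpt` = (A)₁ ∧ (B)₁ holds iff
(a) for every algebraic Hecke character `θ`, every `ℓ, ι` and `v ∣ ℓ`, the pinned datum declares
`r_{θ,ι}|Γ_{K_v}` de Rham AND attaches to it a Weil–Deligne representation of `ι`-class
`rec₁(θ_v ∘ det)` (Λ21: this is (A)₁), and (b) (FM₁) every rank-one `ρ` the datum declares de Rham at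
every `v ∣ ℓ` is a Weil character ((B)₁ minus what (a) already gives).
[cite: BuzzardGeeLMS2014, Conj. 3.2.1 and Conj. 3.2.2] [cite: FontaineMazurGeometric1995, Conj. 1]
[cite: FontaineAsterisque223VIII, §2.3.7] -/
theorem globalLanglandsCorrespondenceGLn_one_iff_pst (𝓡 : ReciprocityData K) :
    GlobalLanglandsCorrespondenceGLn 1 K 𝓡 hcpt ↔
      (∀ (θ : HeckeCharacter K) (p q : InfinitePlace K → ℤ) (hinf : θ.HasInfinityType p q)
        (T : Finset (HeightOneSpectrum (𝓞 K))) (e : HeightOneSpectrum (𝓞 K) → ℕ)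
        (hmod : HeckeCharacter.IsModulus θ T e) (ℓ : ℕ) [Fact ℓ.Prime] (ι : PadicAlgCl ℓ ≃+* ℂ)
        (v : HeightOneSpectrum (𝓞 K)) (hv : ((ℓ : ℕ) : 𝓞 K) ∈ v.asIdeal),
        (𝓡.pst ℓ v hv).IsDeRhamFramed ((hinf.weilRep hmod ι).toLocal v) ∧
          ∃ (r : WeilDeligneRep (v.adicCompletion K) (PadicAlgCl ℓ) (Fin 1 → PadicAlgCl ℓ))
            (rℂ : WeilDeligneRep (v.adicCompletion K) ℂ (Fin 1 → ℂ)),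
            (𝓡.pst ℓ v hv).IsWeilDeligneOf ((hinf.weilRep hmod ι).toLocal v) r ∧
              r.IsTransportAlong (ι : PadicAlgCl ℓ →+* ℂ) rℂ ∧
              rℂ.HasFrobSemisimpleClass
                ((𝓡.llc v).recGL 1 (IrrClass.mk (SmoothIrrep.ofQuasiChar
                  (⟨θ.localComponent v, θ.continuous_localComponent v⟩ :
                    QuasiChar (v.adicCompletion K)))))) ∧
      ∀ (ℓ : ℕ) [Fact ℓ.Prime] (ι : PadicAlgCl ℓ ≃+* ℂ) (ρ : FramedGaloisRep K (PadicAlgCl ℓ) 1),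
        (∀ (v : HeightOneSpectrum (𝓞 K)) (hv : ((ℓ : ℕ) : 𝓞 K) ∈ v.asIdeal),
          (𝓡.pst ℓ v hv).IsDeRhamFramed (ρ.toLocal v)) →
        ∃ (θ : HeckeCharacter K) (p q : InfinitePlace K → ℤ) (hinf : θ.HasInfinityType p q)
          (T : Finset (HeightOneSpectrum (𝓞 K))) (e : HeightOneSpectrum (𝓞 K) → ℕ)
          (hmod : HeckeCharacter.IsModulus θ T e), ρ = hinf.weilRep hmod ι := by
  unfold GlobalLanglandsCorrespondenceGLn
  rw [automorphicToGalois_one_iff_pst 𝓡, galoisToAutomorphic_one_iff_fm_and_wd 𝓡]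
  exact ⟨fun h => ⟨h.1, h.2.1⟩, fun h => ⟨h.1, h.2,
    fun θ p q hinf T e hmod ℓ _ ι _ v hv => (h.1 θ p q hinf T e hmod ℓ ι v hv).2⟩⟩

/-- ★★ **Granting the two in-print theorems the tree keeps as named facts** — Serre/Tate/Conrad
(`r_{θ,ι}` is de Rham above `ℓ`: `HeckeCharacter.exists_lAdic_isDeRhamFramed`) and Patrikis
Prop. 2.2.1 (a de Rham character is a Weil character), both about the CONSTRUCTED `B_dR(K_v)` —
**the summit's `n = 1` conjunct over `K` is exactly**: for every algebraic Hecke character `θ`, every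
`ℓ`, `ι : ℚ̄_ℓ ≃ ℂ` and `v ∣ ℓ`, the pinned datum `fontainePstAdicCompletion v ℓ hv` attaches to
`r_{θ,ι}|Γ_{K_v}` a Weil–Deligne representation whose `ι`-transport has Frobenius-semisimple class
`rec₁(θ_v ∘ det) = [(θ_v ∘ Art_v, 0)]` — Fontaine's value `WD(D_pst(r_{θ,ι}|Γ_{K_v}))`, a property
left undetermined by the datum's specification (`SoloInformedPinExclusionSpec`).
[cite: BuzzardGeeLMS2014, Conj. 3.2.2 and Rem. 3.2.5] [cite: FontaineAsterisque223VIII, §2.3.7]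
[cite: Patrikis2019, Prop. 2.2.1] [cite: SerreAbelianLadic1968, III §2.3 and App. A] -/
theorem globalLanglandsCorrespondenceGLn_one_iff_wd_of_facts
    (hDR : HeckeCharacter.exists_lAdic_isDeRhamFramed)
    (hFM : FramedGaloisRep.exists_heckeCharacter_of_isDeRhamFramed) (𝓡 : ReciprocityData K) :
    GlobalLanglandsCorrespondenceGLn 1 K 𝓡 hcpt ↔
      ∀ (θ : HeckeCharacter K) (p q : InfinitePlace K → ℤ) (hinf : θ.HasInfinityType p q)
        (T : Finset (HeightOneSpectrum (𝓞 K))) (e : HeightOneSpectrum (𝓞 K) → ℕ)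
        (hmod : HeckeCharacter.IsModulus θ T e) (ℓ : ℕ) [Fact ℓ.Prime] (ι : PadicAlgCl ℓ ≃+* ℂ)
        (v : HeightOneSpectrum (𝓞 K)) (hv : ((ℓ : ℕ) : 𝓞 K) ∈ v.asIdeal),
        ∃ (r : WeilDeligneRep (v.adicCompletion K) (PadicAlgCl ℓ) (Fin 1 → PadicAlgCl ℓ))
          (rℂ : WeilDeligneRep (v.adicCompletion K) ℂ (Fin 1 → ℂ)),
          (𝓡.pst ℓ v hv).IsWeilDeligneOf ((hinf.weilRep hmod ι).toLocal v) r ∧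
            r.IsTransportAlong (ι : PadicAlgCl ℓ →+* ℂ) rℂ ∧
            rℂ.HasFrobSemisimpleClass
              ((𝓡.llc v).recGL 1 (IrrClass.mk (SmoothIrrep.ofQuasiChar
                (⟨θ.localComponent v, θ.continuous_localComponent v⟩ :
                  QuasiChar (v.adicCompletion K))))) := by
  rw [globalLanglandsCorrespondenceGLn_one_iff_pst 𝓡]
  refine ⟨fun h θ p q hinf T e hmod ℓ _ ι v hv => (h.1 θ p q hinf T e hmod ℓ ι v hv).2,
    fun h => ⟨fun θ p q hinf T e hmod ℓ _ ι v hv =>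
      ⟨isDeRhamFramed_weilRep_of_fact hDR 𝓡 ι hinf hmod v hv, h θ p q hinf T e hmod ℓ ι v hv⟩,
      fun ℓ _ ι ρ hdR => exists_eq_weilRep_of_isDeRhamFramed hFM 𝓡 ι ρ hdR⟩⟩

end ClauseB

end GLOneRigidity
end Summit.Langlands.Langlands.Theorems
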